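import Literature.NumberTheory.EllipticCurves.LeadingTerm
import Literature.NumberTheory.EllipticCurves.PAdicHeights
import HarnessLib

/-!
# Castella's erratum to Camb. J. Math. 6 (2018) 1–23 (UNREFEREED): Theorem A′ — the `p`-part of BSD in analytic rank one at a multiplicative prime `p > 3`, without semistability

HONEST FRAMING (cell `b2b-bsdres`, BSD rank-≤1 residual classes): the goal is to DELETE the
COMBINATION-SHAPED residual classes for ALL analytic-rank `≤ 1` curves over `ℚ` strictly from
PUBLISHED theorems; construction-shaped classes are TYPED (missing-input `Prop`s), not attempted;
an ANNOUNCED / unrefereed result enters only as an explicitly labelled OPEN hypothesis. This is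
not "finishing BSD".

Sources.
* [Castella2018] F. Castella, *On the `p`-part of the Birch–Swinnerton-Dyer formula for
  multiplicative primes*, Camb. J. Math. 6 (2018) 1–23 (= arXiv:1704.06608), Thm. A (p. 3 of the
  arXiv text): "Let `E/ℚ` be a semistable elliptic curve of conductor `N` with
  `ord_{s=1} L(E,s) = 1`, and let `p > 3` be a prime such that the mod `p` Galois representation
  `ρ̄_{E,p}` … is irreducible. If `p ∣ N`, assume in addition that `E[p]` is ramified at some prime
  `q ≠ p`. Then `ord_p(L'(E,1)/(Reg(E/ℚ) · Ω_E)) = ord_p(#Ш(E/ℚ) ∏_{ℓ∣N} c_ℓ(E/ℚ))`."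
  PUBLISHED — but see the erratum: its proof in the case `p ∣ N` is withdrawn by the author and
  replaced. Thm. A as printed is deliberately NOT transcribed in this file (the cell's literature
  seat owns the published inputs; the caveat below must accompany any transcription of it).
* [Castella2018Erratum] F. Castella, *Erratum to "On the `p`-part of the Birch–Swinnerton-Dyer
  formula for multiplicative primes"*, 5 pp., undated, author's web page
  `https://web.math.ucsb.edu/~castella/Birch-erratum.pdf` (held: `paper:url-e83251f1873d`, read in
  full 2026-08-18). UNREFEREED. p. 1: "We fix a mistake in [Cas18] and prove a version of the
  main Theorem A in op. cit. that is both weaker and stronger than the original result. … When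
  `f ∈ 𝕀[[q]]` is a Hida family passing through a `p`-new `p`-stabilized newform in weight 2, the
  existence of a point `φ ∈ 𝒳_𝕀^a` as used in the proof of [Cas18, Thm. 4.2] is not guaranteed in
  general. This affects the proof of [op. cit., Thm. 4.4]. In the case `p ∥ N` (which is the case
  where such `f` arises, so we only consider this case below), Theorem 4.4 in [Cas18] should be
  replaced by Theorem 1.1 below, which we shall prove here without using [Cas18, Thm. 4.2] and
  allowing `E` to have primes of additive reduction. … Using Theorem 1.1 in place of
  [Cas18, Thm. 4.4], the same argument as in [Cas18, §5] yields the following result, which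
  should replace the main Theorem A in op. cit. when `p ∥ N`." **Theorem A′** (p. 1): "Let `E/ℚ`
  be an elliptic curve of conductor `N` with multiplicative reduction at `p > 3`. Assume that
  `E[p]` is irreducible as a `G_ℚ`-module, `E` has nonsplit multiplicative reduction at some prime
  `q ≠ p` where `E[p]` is ramified, and `E(ℚ_p)[p] = 0`. If `ord_{s=1} L(E,s) = 1`, then
  `ord_p(L'(E,1)/(Reg(E/ℚ) · Ω_E)) = ord_p(#Ш(E/ℚ) ∏_{ℓ∣N} c_ℓ(E/ℚ))`, where `Reg(E/ℚ)` is the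
  discriminant of the Néron–Tate height pairing on `E(ℚ) ⊗ ℝ`; `Ω_E` is the Néron period of `E`;
  `Ш(E/ℚ)` is the Tate–Shafarevich group of `E`; and `c_ℓ(E/ℚ)` is the Tamagawa number of `E` at
  the prime `ℓ`, and hence the `p`-part of the Birch and Swinnerton-Dyer formula holds for `E`."
  Remark (pp. 1–2): "Compared to Theorem A of [Cas18] in the case `p ∥ N`, Theorem A′ assumes in
  addition that (1) the prime `q ∥ N` different from `p` where `E[p]` is required to ramify should
  be a prime of nonsplit multiplicative reduction for `E`; (2) `E(ℚ_p)[p] = 0`, but does not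
  require the `E` to be semistable." DEPENDENCY: the proof of the erratum's Thm. 2.3 (from which
  Thm. 1.1 and A′ follow) invokes "[FW21, Thm. 4.41]" = Fouquet–Wan, arXiv:2107.13726
  [FouquetWan2021], UNREFEREED, for the divisibility (2.4) (p. 4: "By [FW21, Thm. 4.41], we then
  have the divisibility (2.4)"). The erratum's Thm. 1.1 is restated as Thm. 3.1 of Castella,
  arXiv:2409.01360v1 [Castella2024] ("This is [cas-CJM], in the final form given in
  [cas-CJM-err]"), itself v1-only and unrefereed as of August 2026
  (`papers/BirchSwinnertonDyer/bsd-percentage/FRESHNESS.md`).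

STATUS, therefore: **PRE** (unrefereed, resting on an unrefereed input). The `Prop` below carries
the tag `[claim: …, status: under-review]` and the suffix `_OPEN`; it is to be taken as an
explicitly labelled open hypothesis, and a class theorem using it is CONDITIONAL (cell referee
protocol R0/A5). Consequence recorded for the census (`RESIDUAL-CASES.md` §a.1 row C4 = census row
`T-CAS`, which applies [Castella2018] Thm. A exactly in the case `p ∣ N`): at a prime `p ∥ N`,
`p ≥ 5`, the analytic-rank-one `p`-part has today NO complete published proof at the class level —
the printed one is withdrawn at `p ∥ N` by its author, the replacement is this unrefereed A′ (and
Skinner–Zhang, arXiv:1407.1099, Thm. 1.2, also unrefereed, `SkinnerZhang2014/`).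

## Transcription (tree vocabulary; conventions of bsd.S30 `padicValRat_bsd_rank_zero`)

* `E` = a globally minimal Weierstrass equation `W/ℚ`; `p > 3` prime = `5 ≤ p`;
  multiplicative / nonsplit multiplicative reduction = `W.HasMultiplicativeReductionAtPrime`,
  `¬ W.HasSplitMultiplicativeReductionAtPrime` (`Tamagawa`, `PAdicHeights`); `E[p]` irreducible =
  `W.HasIrreducibleModPGaloisRep p` (`GaloisAction`).
* "`E[p]` is ramified at `q`" for a multiplicative `q ≠ p` = `¬ p ∣ padicValInt q W.minimalDiscriminantInt`
  (Tate's parametrisation over `ℚ_q`, resp. its unramified quadratic twist in the nonsplit case: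
  `E[p]` is unramified at `q` iff `p ∣ v_q(Δ_min)`; exactly bsd.S30's binder `haux`).
* "`E(ℚ_p)[p] = 0`" = every `ℚ_p`-rational point killed by `p` is zero, on the base change of `W`
  to `ℚ_p` (the group `E(ℚ_p)` does not depend on the model).
* Conclusion in the print shape of bsd.S30, analytic rank one: `W.leadingLCoeff = L'(E,1)`,
  `W.regulator = Reg(E/ℚ)` (Gram determinant of the Néron–Tate pairing, `ĥ` Clay-normalised; a
  power of `2` in the normalisation is invisible to `ord_p`, `p ≥ 5`), `W.realPeriodRat = Ω_E`
  (Néron period, globally minimal `W`), `W.shaOrder = #Ш` under the binder `Finite W.sha`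
  (Gross–Zagier–Kolyvagin, bsd.S17, kept as a binder as in bsd.S30), `W.tamagawaProduct = ∏ c_ℓ`;
  no torsion term (`E(ℚ)[p] = 0` as `E[p]` is irreducible). Rationality of the quotient is part of
  the transcription (`∃ q : ℚ`), as in bsd.S30.
-/

noncomputable section

open scoped Classical

open WeierstrassCurve

namespace Literature.NumberTheory.EllipticCurves.Castella2018

/-- **OPEN HYPOTHESIS — UNREFEREED (author's web erratum, n.d., whose input Thm. 1.1 is restated as
arXiv:2409.01360v1 Thm. 3.1 — Thm. A′ itself is not restated there; proof uses Fouquet–Wan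
arXiv:2107.13726 Thm. 4.41, unrefereed).** Castella, *Erratum to
"On the `p`-part of the Birch–Swinnerton-Dyer formula for multiplicative primes"*, **Theorem A′**
(p. 1): "Let `E/ℚ` be an elliptic curve of conductor `N` with multiplicative reduction at `p > 3`.
Assume that `E[p]` is irreducible as a `G_ℚ`-module, `E` has nonsplit multiplicative reduction at
some prime `q ≠ p` where `E[p]` is ramified, and `E(ℚ_p)[p] = 0`. If `ord_{s=1} L(E,s) = 1`, then
`ord_p(L'(E,1)/(Reg(E/ℚ) · Ω_E)) = ord_p(#Ш(E/ℚ) ∏_{ℓ∣N} c_ℓ(E/ℚ))` … and hence the `p`-part of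
the Birch and Swinnerton-Dyer formula holds for `E`." It "should replace the main Theorem A in
[Castella, Camb. J. Math. 6 (2018)] when `p ∥ N`" (erratum p. 1), adds the hypotheses "nonsplit"
and "`E(ℚ_p)[p] = 0`", and "does not require the `E` to be semistable" (p. 2). Transcription
(module docstring): globally minimal `W`, `5 ≤ p`, binders `hmult`, `hirr`, `hq` (a nonsplit
multiplicative prime `q ≠ p` with `p ∤ v_q(Δ_min)`), `htors` (`E(ℚ_p)[p] = 0` on `W/ℚ_p`),
`W.analyticRank = 1`, `Finite W.sha` (Gross–Zagier–Kolyvagin, kept as a binder); conclusion: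
`L'(E,1)/(Ω_E · Reg)` is a rational `q'` with `ord_p q' = ord_p #Ш + ord_p ∏ c_ℓ`. NEVER cite this
`Prop` as a theorem: take it as an explicit hypothesis; a result using it is conditional on an
unrefereed claim. [claim: Castella2018Erratum, status: under-review] -/
def erratum_thmAprime_padicVal_bsd_rankOne_OPEN : Prop :=
  ∀ (W : WeierstrassCurve ℚ) [W.IsElliptic] [W.IsGloballyMinimal] (p : ℕ) [Fact p.Prime],
    5 ≤ p → W.HasMultiplicativeReductionAtPrime p → W.HasIrreducibleModPGaloisRep p →
    (∃ (q : ℕ) (_ : Fact q.Prime), q ≠ p ∧ W.HasMultiplicativeReductionAtPrime q ∧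
      ¬ W.HasSplitMultiplicativeReductionAtPrime q ∧ ¬ p ∣ padicValInt q W.minimalDiscriminantInt) →
    (∀ P : (W.baseChange ℚ_[p]).toAffine.Point, p • P = 0 → P = 0) →
    W.analyticRank = 1 → Finite W.sha →
    ∃ q' : ℚ, W.leadingLCoeff / ((W.realPeriodRat * W.regulator : ℝ) : ℂ) = (q' : ℂ) ∧
      padicValRat p q' = (padicValNat p W.shaOrder : ℤ) + padicValNat p W.tamagawaProduct

end Literature.NumberTheory.EllipticCurves.Castella2018

end
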